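/-
b2b-lace packet, LEAN TYPING SEAT 1 gen 19 (unit `b2b-lace-lean1-g19`), node N76-X3-tr2c-all (JOINT step of tranche 2c):
the stacking result for the engine tokens `h1ker` + `h2ker` + `h3ker` over the kernel of lines 1–3.
ADDITIVE: no file of record is touched; imports the three hexagon kernels `NobleBoundsN0PsiLowerHexOne` (p206173, carver-g26),
`NobleBoundsN0PsiLowerHexTwo` (p205944, lean1-g19) and `NobleBoundsN0PsiLowerThree` (p205221, carver-g26) unchanged.
-/
import Literature.Probability.FitznerVanDerHofstad2017.NobleBoundsN0PsiLowerThree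
import Literature.Probability.FitznerVanDerHofstad2017.NobleBoundsN0PsiLowerHexOne
import Literature.Probability.FitznerVanDerHofstad2017.NobleBoundsN0PsiLowerHexTwo
import HarnessLib

/-!
# The kernel of (5.25), lines 1–5, with all three position classes of the six-cycles under one `Σ_x`

CITATION HEADER (PLACEMENT v11). This module is part of a certified REPRODUCTION of:
R. Fitzner, R. van der Hofstad, *Mean-field behavior for nearest-neighbor percolation in `d > 10`*,
Electron. J. Probab. 22 (2017), no. 43, 1–65 [FvdH17] (arXiv:1506.07977; extended version = arXiv:1506.07977v1
[FvdH17-ext]).  Reproduces: LINES 1–5 of [FvdH17-ext] Lemma 5.3 (5.25) p. 48 — the lower bound on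
`Ψ̂^{(0),κ}_p(0) = Σ_x Ψ^{(0),κ}_p(x)` — in the tree's DEFINITION-CONSISTENT form, as the JOINT statement that the kernel
of lines 1–3 (`FvdH17ext_L53_psiZero_sum_lower`, module `NobleBoundsN0PsiLower`; `FvdH17ext_L53_psiZero_line3_sum_lower`,
module `NobleBoundsN0PsiLowerTwo`) and the THREE position classes of lines 4–5 — the contribution of "the `32d(d−1)(d−2)`
paths that return to the origin in `6` steps using three different dimensions" (proof [FvdH17-ext] §6.1 p. 61, the
sentence after the display following (6.47)) at the positions `|x|₁ = 1` (module `NobleBoundsN0PsiLowerHexOne`),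
`|x|₁ = 2` (module `NobleBoundsN0PsiLowerHexTwo`) and `|x|₁ = 3` (module `NobleBoundsN0PsiLowerThree`) — hold
SIMULTANEOUSLY: their kernels ADD under the single position sum.
Origin: build `lace`, seat lean1 (gen 19), node N76-X3 tranche 2c (G25 (c2) "hexagon kernel"), joint step.

WHAT THIS MODULE DOES.  Nothing new at any single position.  At each position class the position-sum lower bound of
the corresponding module is used verbatim — `FvdH17ext_L53_psiZero_lines12h1_sum_lower` (lines 1–2 and the class-1
hexagons, at the `2d−1` positions `e_ν`, `ν ≠ κ`), `FvdH17ext_L53_psiZero_line3h2_sum_lower` (line 3 and the class-2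
hexagons, at the positions `e_ρ + e_ι`), `FvdH17ext_L53_psiZero_line45_sum_lower` (the class-3 hexagons, at the
positions `e_α + e_β + e_γ`) — each bounding the PROBABILITY of the event of `Ψ^{(0),κ}_p(x)` at its positions from
below; the three position sets are pairwise disjoint (`sum_one_add_sum_two_add_sum_three_le_tsum` of
`NobleBoundsN0PsiLowerThree`), so the three kernels add inside `Σ_x Ψ^{(0),κ}_p(x)`
(`FvdH17ext_L53_psiZero_lines12345_tsum_lower`, `hd : 2 ≤ d`).  The monotone closed form
(`FvdH17ext_L53_psiZero_lines12345_lower_of_tau_le`, `hd : 3 ≤ d`, the five two-point letters of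
`NobleBoundsN0PsiLowerTwo` and `Tmax ≥ τ_p(z)` for every `z ≠ 0` that is not a unit vector) is the SUM of the three
modules' closed forms over the common lines-1–3 part:
`[lines 1–3 closed form of NobleBoundsN0PsiLowerTwo]
 + 16(d−1)(d−2)(2d−5) · p⁶ · hexOneBracket(d, p, Tmax, T3)`                                   (class 1, `NobleBoundsN0PsiLowerHexOne`)
`+ 2(d−1)(d−2) p⁶ [(d−2)(16 − 8p − 40p² − 56p³ − 104p⁴ − 32p⁵ − 16p⁶ − 16 T3 − 80 Tmax) − (d−3)²(16p³ + 144p⁴ + 64p⁵ + 32p⁶)]`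
                                                                                              (class 2, `NobleBoundsN0PsiLowerHexTwo`)
`+ (3/2)(2d−2)(2d−3)(2d−4) p⁶ (1 − 8p² − 5 Tmax − T3)`                                         (class 3, `NobleBoundsN0PsiLowerThree`);
the field form `FvdH17ext_L53_psiZeroLower_field_lines12345 {L} (hL)` is the one a certificate revision consumes.
STACKING RULE (for the numerics seats; engine tokens `h1ker`, `h2ker`, `h3ker`): the three hexagon addends may be stacked
TOGETHER on the lines-1–3 kernel only through THIS module's field lemma; each single-class module alone licenses its own
addend alone.

DIVERGENCE (recorded in the packet under node N76-X3 / G25 (c2); no sentence about any particular dimension).  Print's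
lines 4–5 carry the constant `64d(d−1)(d−2)` of "the `32d(d−1)(d−2)` paths that return to the origin in `6` steps using
three different dimensions" (proof §6.1 p. 61), Harris-type factors and print's bracket; the three class modules prove
position shares of this with union-bound brackets in place of print's factors and bracket and the plain two-point value
at every vertex `v ≠ x`, and OMIT some six-cycles (class 1: those using the axis `κ.1`; class 2: the planar ones and
those with an axis `κ.1`; every class: the positions where the top `x − e_κ` would be a vertex).  Every omitted term is
a non-negative addend of a LOWER bound, so the joint statement is weaker than, and implied by the argument of, print's
lines 1–5; it does NOT assert print's constants.

SCOPE.  Additive; three proved position-sum inequalities added under one `Σ_x` and regrouped; no event, no measure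
computation and no numeral of record is introduced or moved.  Two one-line helpers are re-derived locally (§A).

[cite: FitznerVanDerHofstad2017, Lemma 5.3 (5.25) lines 1–5 (extended version arXiv:1506.07977v1 p. 48), proof §6.1 (6.45)–(6.47) and the text after (6.47) p. 61]
[cite: GrimmettPercolation1999, §1.3 p. 10 (product measure)]
-/

noncomputable section

namespace Literature.Probability.FitznerVanDerHofstad2017

open _root_.MeasureTheory Literature.Barriers.CriticalPhenomena Literature.Probability.Percolation
open Literature.Probability.LatticeModels
open scoped BigOperators ENNReal

local notation "𝐞" => Literature.Probability.Percolation.stepVec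

variable {d : ℕ}

/-! ### A. Two local helpers (copies of private facts of the class modules) -/

/-- `(e_a)_{a.1} = ±1`. [folklore] -/
private theorem hexAll_stepVec_apply_fst (a : Fin d × Bool) : (𝐞 a : Site d) a.1 = if a.2 then 1 else -1 := by
  rw [stepVec_eq_single]
  simp

/-- `(e_a)_j = 0` for `j ≠ a.1`. [folklore] -/
private theorem hexAll_stepVec_apply_of_fst_ne {a : Fin d × Bool} {j : Fin d} (h : a.1 ≠ j) :
    (𝐞 a : Site d) j = 0 := by
  rw [stepVec_eq_single]
  simp [Ne.symm h]

/-- A `|x|₁ = 2` position off the diagonal is not `0`. [folklore] -/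
private theorem hexAll_two_site_ne_zero {ι ρ : Fin d × Bool} (hρι : ρ.1 ≠ ι.1) : (𝐞 ρ : Site d) + 𝐞 ι ≠ 0 := by
  intro h
  have h1 := congr_fun h ρ.1
  rw [Pi.add_apply, hexAll_stepVec_apply_fst, hexAll_stepVec_apply_of_fst_ne (Ne.symm hρι), Pi.zero_apply] at h1
  split_ifs at h1 <;> norm_num at h1

/-- A `|x|₁ = 3` position of a live triple is not `0`. [folklore] -/
private theorem hexAll_pos3_ne_zero {κ : Fin d × Bool} {q : (Fin d × Bool) × (Fin d × Bool) × (Fin d × Bool)}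
    (hq : q ∈ threeTriples κ) : pos3 q ≠ 0 := by
  have hq' : q.1.1 ≠ q.2.1.1 ∧ q.1.1 ≠ q.2.2.1 := by
    simp only [threeTriples, Finset.mem_filter, Finset.mem_univ, true_and] at hq
    exact ⟨hq.1, hq.2.1⟩
  intro h
  have h1 := congr_fun h q.1.1
  rw [pos3, Pi.add_apply, Pi.add_apply, hexAll_stepVec_apply_fst, hexAll_stepVec_apply_of_fst_ne (Ne.symm hq'.1),
    hexAll_stepVec_apply_of_fst_ne (Ne.symm hq'.2), Pi.zero_apply] at h1
  split_ifs at h1 <;> norm_num at h1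

/-! ### B. The three position classes under one `Σ_x` -/

/-- **Kernel (5.25), lines 1–5, all three position classes of the six-cycles** (definition-consistent form): for
`p < p_c` and every direction `κ`,
`p · ((2d−2)² p³ − psiZeroLowerSubClasses) + Σ_{ν ≠ κ} Σ_{h ∈ hexIdx ν κ} (p⁶ − hexOneLoss − p⁶ psiOneSub)
 + ½ Σ_{q ∈ twoPairs κ} [(p⁴ − p⁴ psiTwoSub q) + Σ_{f ∈ hexTwoFam κ q} (hexTwoPoly − p⁶ psiHexTwoSub)]
 + ⅙ Σ_{q ∈ threeTriples κ} Σ_{h ∈ hex9} (p⁶ − 8p⁸ − p⁶ psiThreeSub q h) ≤ Ψ̂^{(0),κ}_p(0) = Σ_x Ψ^{(0),κ}_p(x)`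
(the factors `½`, `⅙`: each `|x|₁ = 2` position is two ordered pairs, each `|x|₁ = 3` position six ordered triples).
[cite: FitznerVanDerHofstad2017, Lemma 5.3 (5.25) lines 1–5 (extended version arXiv:1506.07977v1 p. 48), proof §6.1 (6.45)–(6.47) and the text after (6.47) p. 61] -/
theorem FvdH17ext_L53_psiZero_lines12345_tsum_lower (hd : 2 ≤ d) (p : unitInterval) (hp : p < criticalProbI d)
    (κ : Fin d × Bool) {a b c : Fin d} (hab : a ≠ b) (hac : a ≠ c) (hbc : b ≠ c) :
    (p : ℝ) * ((2 * d - 2 : ℝ) ^ 2 * (p : ℝ) ^ 3 - psiZeroLowerSubClasses d p a b c) +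
        ∑ ν ∈ Finset.univ.erase κ, ∑ h ∈ hexIdx ν κ,
          ((p : ℝ) ^ 6 - hexOneLoss d p ν κ h - (p : ℝ) ^ 6 * psiOneSub d p ν κ h) +
        (1 / 2) * ∑ q ∈ twoPairs κ, (((p : ℝ) ^ 4 - (p : ℝ) ^ 4 * psiTwoSub d p κ q) +
          ∑ f ∈ hexTwoFam κ q, (hexTwoPoly p (thirdAxes κ q).card f.2 - (p : ℝ) ^ 6 * psiHexTwoSub d p κ q f.1 f.2)) +
        (1 / 6) * ∑ q ∈ threeTriples κ, ∑ h ∈ hex9,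
          ((p : ℝ) ^ 6 - 8 * (p : ℝ) ^ 8 - (p : ℝ) ^ 6 * psiThreeSub d p κ q h) ≤
      ∑' x, noblePsiN d p (𝐞 κ) 0 x := by
  classical
  have hd1 : 1 ≤ d := by omega
  -- the class-1 positions, lines 1–2 included (valid for every `p`)
  have h1 := FvdH17ext_L53_psiZero_lines12h1_sum_lower hd p hp κ hab hac hbc
  -- the three position sets under one `Σ_x`
  have h5 := sum_one_add_sum_two_add_sum_three_le_tsum hd p hp κ
  have hB : 0 ≤ ∑ q ∈ (twoPairs κ).filter (fun q => q.1.1 < q.2.1), noblePsiN d p (𝐞 κ) 0 (𝐞 q.2 + 𝐞 q.1) :=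
    Finset.sum_nonneg fun q _ => noblePsiN_nonneg' p _ _ _
  have hC : 0 ≤ ∑ x ∈ (threeTriples κ).image pos3, noblePsiN d p (𝐞 κ) 0 x :=
    Finset.sum_nonneg fun x _ => noblePsiN_nonneg' p _ _ _
  rcases eq_or_lt_of_le p.2.1 with hp0 | hp0
  · have hz : (p : ℝ) = 0 := hp0.symm
    have hsum2 : ∑ q ∈ twoPairs κ, (((p : ℝ) ^ 4 - (p : ℝ) ^ 4 * psiTwoSub d p κ q) +
        ∑ f ∈ hexTwoFam κ q, (hexTwoPoly p (thirdAxes κ q).card f.2 - (p : ℝ) ^ 6 * psiHexTwoSub d p κ q f.1 f.2)) ≤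
        0 := by
      refine Finset.sum_nonpos fun q hq => ?_
      refine (FvdH17ext_L53_psiZero_line3h2_pair_lower_union hd1 hq p).trans ((measureReal_hexTwoUnion_le hq p).trans ?_)
      rw [hz]
      norm_num
    have hsum3 : ∑ q ∈ threeTriples κ, ∑ h ∈ hex9,
        ((p : ℝ) ^ 6 - 8 * (p : ℝ) ^ 8 - (p : ℝ) ^ 6 * psiThreeSub d p κ q h) = 0 :=
      Finset.sum_eq_zero fun q _ => Finset.sum_eq_zero fun h _ => by rw [hz]; ring
    rw [hsum3, mul_zero, add_zero]
    linarith
  have hp1 : (p : ℝ) < 1 := lt_of_lt_of_le (Subtype.coe_lt_coe.2 hp) (criticalProbI d).2.2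
  -- the class-2 positions, line 3 included
  have h3 := FvdH17ext_L53_psiZero_line3h2_sum_lower hd1 p κ
  rw [sum_twoPairs_eq_two_mul_sum_lt κ (fun x => (bondPercolation (zdGraph d) p).real (psiZeroEventSite x κ))] at h3
  have h4 : ∑ q ∈ (twoPairs κ).filter (fun q => q.1.1 < q.2.1),
      (bondPercolation (zdGraph d) p).real (psiZeroEventSite (𝐞 q.2 + 𝐞 q.1) κ) ≤
        ∑ q ∈ (twoPairs κ).filter (fun q => q.1.1 < q.2.1), noblePsiN d p (𝐞 κ) 0 (𝐞 q.2 + 𝐞 q.1) :=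
    Finset.sum_le_sum fun q hq => measureReal_psiZeroEventSite_le_noblePsiN hd1 p hp0 hp1 κ
      (hexAll_two_site_ne_zero (mem_twoPairs.1 (Finset.mem_filter.1 hq).1).1)
  -- the class-3 positions
  have h6 := FvdH17ext_L53_psiZero_line45_sum_lower hd1 p κ
  have h7 : ∑ q ∈ threeTriples κ, (bondPercolation (zdGraph d) p).real (psiZeroEventSite (pos3 q) κ) ≤
      ∑ q ∈ threeTriples κ, noblePsiN d p (𝐞 κ) 0 (pos3 q) :=
    Finset.sum_le_sum fun q hq => measureReal_psiZeroEventSite_le_noblePsiN hd1 p hp0 hp1 κ (hexAll_pos3_ne_zero hq)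
  have h8 := sum_threeTriples_le_six_mul_sum_image κ (g := fun x => noblePsiN d p (𝐞 κ) 0 x)
    fun x => noblePsiN_nonneg' p _ _ _
  linarith

/-! ### C. The monotone closed form and the field lemma -/

/-- **Monotone form of the kernel (5.25), lines 1–5, all three position classes**: any upper bounds
`T2 ≥ τ_p(2e₁)`, `T11 ≥ τ_p(e₁+e₂)`, `T21 ≥ τ_p(2e₁+e₂)`, `T111 ≥ τ_p(e₁+e₂+e₃)`, `T3 ≥ τ_{3,p}(e₁)` with `T2 ≤ T11`,
`T21 ≤ T111`, and `Tmax ≥ τ_p(z)` for every `z ≠ 0` that is not a unit vector, give the uniform-in-`κ` bound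
`[lines 1–3 closed form of NobleBoundsN0PsiLowerTwo] + 16(d−1)(d−2)(2d−5) p⁶ hexOneBracket
 + 2(d−1)(d−2) p⁶ [(d−2)(16 − 8p − 40p² − 56p³ − 104p⁴ − 32p⁵ − 16p⁶ − 16 T3 − 80 Tmax) − (d−3)²(16p³ + 144p⁴ + 64p⁵ + 32p⁶)]
 + (3/2)(2d−2)(2d−3)(2d−4) p⁶ (1 − 8p² − 5 Tmax − T3) ≤ Ψ̂^{(0),κ}_p(0)` for `3 ≤ d`.
[cite: FitznerVanDerHofstad2017, Lemma 5.3 (5.25) lines 1–5 (extended version arXiv:1506.07977v1 p. 48), proof §6.1 (6.45)–(6.47) and the text after (6.47) p. 61] -/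
theorem FvdH17ext_L53_psiZero_lines12345_lower_of_tau_le (hd : 3 ≤ d) (p : unitInterval) (hp : p < criticalProbI d)
    {a b c : Fin d} (hab : a ≠ b) (hac : a ≠ c) (hbc : b ≠ c) {T2 T11 T21 T111 T3 Tmax : ℝ}
    (h2 : tau d p 0 (Pi.single a 2) ≤ T2) (h11 : tau d p 0 (Pi.single a 1 + Pi.single b 1) ≤ T11)
    (h21 : tau d p 0 (Pi.single a 2 + Pi.single b 1) ≤ T21)
    (h111 : tau d p 0 (Pi.single a 1 + Pi.single b 1 + Pi.single c 1) ≤ T111) (h3 : tauGe d p 3 (unitSite1 d) ≤ T3)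
    (hT2 : T2 ≤ T11) (hT21 : T21 ≤ T111)
    (hmax : ∀ z : Site d, z ≠ 0 → (∀ ν : Fin d × Bool, z ≠ 𝐞 ν) → tau d p 0 z ≤ Tmax) (κ : Fin d × Bool) :
    (p : ℝ) * ((2 * d - 2 : ℝ) ^ 2 * (p : ℝ) ^ 3 -
        ((p : ℝ) ^ 3 * ((2 * d - 2 : ℝ) * (2 * T2 + 2 * (2 * d - 3 : ℝ) * T11 + 2 * T21 + (2 * d - 4 : ℝ) * T111)) +
          (2 * d - 2 : ℝ) ^ 2 * (p : ℝ) ^ 3 * T3 + (2 * d - 2 : ℝ) * (2 * d - 3) ^ 2 * (p : ℝ) ^ 6)) +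
      2 * ((d : ℝ) - 1) ^ 2 * (p : ℝ) ^ 4 * (1 - T111 - 2 * T11 - T3) +
      16 * ((d : ℝ) - 1) * ((d : ℝ) - 2) * (2 * (d : ℝ) - 5) * ((p : ℝ) ^ 6 * hexOneBracket d p Tmax T3) +
      2 * ((d : ℝ) - 1) * ((d : ℝ) - 2) * (p : ℝ) ^ 6 *
        (((d : ℝ) - 2) * (16 - 8 * (p : ℝ) - 40 * (p : ℝ) ^ 2 - 56 * (p : ℝ) ^ 3 - 104 * (p : ℝ) ^ 4 -
            32 * (p : ℝ) ^ 5 - 16 * (p : ℝ) ^ 6 - 16 * T3 - 80 * Tmax) -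
          ((d : ℝ) - 3) ^ 2 * (16 * (p : ℝ) ^ 3 + 144 * (p : ℝ) ^ 4 + 64 * (p : ℝ) ^ 5 + 32 * (p : ℝ) ^ 6)) +
      (3 / 2) * ((2 * d - 2 : ℝ) * (2 * d - 3) * (2 * d - 4)) * ((p : ℝ) ^ 6 * (1 - 8 * (p : ℝ) ^ 2 - 5 * Tmax - T3)) ≤
      ∑' x, noblePsiN d p (𝐞 κ) 0 x := by
  have hd2 : 2 ≤ d := by omega
  refine le_trans ?_ (FvdH17ext_L53_psiZero_lines12345_tsum_lower hd2 p hp κ hab hac hbc)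
  have hsub := psiZeroLowerSubClasses_le_of_tau_le hd2 p (a := a) (b := b) (c := c) h2 h11 h21 h111 h3
  have hsum3 := sum_twoPairs_lower_of_tau_le hd2 p κ hab hac hbc h2 h11 h21 h111 h3 hT2 hT21
  have hhex1 := sum_hexOne_lower_of_tau_le hd2 p κ hmax h3
  have hhex3 := sum_threeTriples_lower_of_tau_le hd2 p κ hmax h3
  have hsumH : ∑ q ∈ twoPairs κ, ∑ f ∈ hexTwoFam κ q,
      (hexTwoPoly p (thirdAxes κ q).card f.2 - (p : ℝ) ^ 6 * psiHexTwoSub d p κ q f.1 f.2) ≥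
      ∑ q ∈ twoPairs κ, ((thirdAxes κ q).card : ℝ) * ((p : ℝ) ^ 6 * (16 - 8 * (p : ℝ) - 40 * (p : ℝ) ^ 2 -
        56 * (p : ℝ) ^ 3 - 104 * (p : ℝ) ^ 4 - 32 * (p : ℝ) ^ 5 - 16 * (p : ℝ) ^ 6 -
        (((thirdAxes κ q).card : ℝ) - 1) * (16 * (p : ℝ) ^ 3 + 144 * (p : ℝ) ^ 4 + 64 * (p : ℝ) ^ 5 + 32 * (p : ℝ) ^ 6) -
        16 * T3 - 80 * Tmax)) :=
    Finset.sum_le_sum fun q hq => sum_hexTwoFam_lower_of_tau_le p hq h3 hmax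
  have hcount : ∑ q ∈ twoPairs κ, ((thirdAxes κ q).card : ℝ) * ((p : ℝ) ^ 6 * (16 - 8 * (p : ℝ) - 40 * (p : ℝ) ^ 2 -
        56 * (p : ℝ) ^ 3 - 104 * (p : ℝ) ^ 4 - 32 * (p : ℝ) ^ 5 - 16 * (p : ℝ) ^ 6 -
        (((thirdAxes κ q).card : ℝ) - 1) * (16 * (p : ℝ) ^ 3 + 144 * (p : ℝ) ^ 4 + 64 * (p : ℝ) ^ 5 + 32 * (p : ℝ) ^ 6) -
        16 * T3 - 80 * Tmax)) =
      4 * ((d : ℝ) - 1) * ((d : ℝ) - 2) * (((d - 3 : ℕ) : ℝ) * ((p : ℝ) ^ 6 * (16 - 8 * (p : ℝ) - 40 * (p : ℝ) ^ 2 -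
        56 * (p : ℝ) ^ 3 - 104 * (p : ℝ) ^ 4 - 32 * (p : ℝ) ^ 5 - 16 * (p : ℝ) ^ 6 -
        (((d - 3 : ℕ) : ℝ) - 1) * (16 * (p : ℝ) ^ 3 + 144 * (p : ℝ) ^ 4 + 64 * (p : ℝ) ^ 5 + 32 * (p : ℝ) ^ 6) -
        16 * T3 - 80 * Tmax))) +
      4 * ((d : ℝ) - 1) * (((d - 2 : ℕ) : ℝ) * ((p : ℝ) ^ 6 * (16 - 8 * (p : ℝ) - 40 * (p : ℝ) ^ 2 -
        56 * (p : ℝ) ^ 3 - 104 * (p : ℝ) ^ 4 - 32 * (p : ℝ) ^ 5 - 16 * (p : ℝ) ^ 6 -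
        (((d - 2 : ℕ) : ℝ) - 1) * (16 * (p : ℝ) ^ 3 + 144 * (p : ℝ) ^ 4 + 64 * (p : ℝ) ^ 5 + 32 * (p : ℝ) ^ 6) -
        16 * T3 - 80 * Tmax))) :=
    sum_twoPairs_thirdAxes hd2 κ fun m => (m : ℝ) * ((p : ℝ) ^ 6 * (16 - 8 * (p : ℝ) - 40 * (p : ℝ) ^ 2 -
        56 * (p : ℝ) ^ 3 - 104 * (p : ℝ) ^ 4 - 32 * (p : ℝ) ^ 5 - 16 * (p : ℝ) ^ 6 -
        ((m : ℝ) - 1) * (16 * (p : ℝ) ^ 3 + 144 * (p : ℝ) ^ 4 + 64 * (p : ℝ) ^ 5 + 32 * (p : ℝ) ^ 6) -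
        16 * T3 - 80 * Tmax))
  have hcast3 : ((d - 3 : ℕ) : ℝ) = (d : ℝ) - 3 := by
    rw [Nat.cast_sub hd]
    norm_num
  have hcast2 : ((d - 2 : ℕ) : ℝ) = (d : ℝ) - 2 := by
    rw [Nat.cast_sub hd2]
    norm_num
  rw [hcast3, hcast2] at hcount
  rw [hcount] at hsumH
  have hfirst : (p : ℝ) * ((2 * d - 2 : ℝ) ^ 2 * (p : ℝ) ^ 3 -
      ((p : ℝ) ^ 3 * ((2 * d - 2 : ℝ) * (2 * T2 + 2 * (2 * d - 3 : ℝ) * T11 + 2 * T21 + (2 * d - 4 : ℝ) * T111)) +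
        (2 * d - 2 : ℝ) ^ 2 * (p : ℝ) ^ 3 * T3 + (2 * d - 2 : ℝ) * (2 * d - 3) ^ 2 * (p : ℝ) ^ 6)) ≤
      (p : ℝ) * ((2 * d - 2 : ℝ) ^ 2 * (p : ℝ) ^ 3 - psiZeroLowerSubClasses d p a b c) :=
    mul_le_mul_of_nonneg_left (by linarith) p.2.1
  have hsecond : 2 * ((d : ℝ) - 1) ^ 2 * (p : ℝ) ^ 4 * (1 - T111 - 2 * T11 - T3) =
      (1 / 2) * ((2 * d - 2 : ℝ) ^ 2 * ((p : ℝ) ^ 4 * (1 - T111 - 2 * T11 - T3))) := by ring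
  have hthird : 2 * ((d : ℝ) - 1) * ((d : ℝ) - 2) * (p : ℝ) ^ 6 *
        (((d : ℝ) - 2) * (16 - 8 * (p : ℝ) - 40 * (p : ℝ) ^ 2 - 56 * (p : ℝ) ^ 3 - 104 * (p : ℝ) ^ 4 -
            32 * (p : ℝ) ^ 5 - 16 * (p : ℝ) ^ 6 - 16 * T3 - 80 * Tmax) -
          ((d : ℝ) - 3) ^ 2 * (16 * (p : ℝ) ^ 3 + 144 * (p : ℝ) ^ 4 + 64 * (p : ℝ) ^ 5 + 32 * (p : ℝ) ^ 6)) =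
      (1 / 2) * (4 * ((d : ℝ) - 1) * ((d : ℝ) - 2) * (((d : ℝ) - 3) * ((p : ℝ) ^ 6 * (16 - 8 * (p : ℝ) - 40 * (p : ℝ) ^ 2 -
        56 * (p : ℝ) ^ 3 - 104 * (p : ℝ) ^ 4 - 32 * (p : ℝ) ^ 5 - 16 * (p : ℝ) ^ 6 -
        (((d : ℝ) - 3) - 1) * (16 * (p : ℝ) ^ 3 + 144 * (p : ℝ) ^ 4 + 64 * (p : ℝ) ^ 5 + 32 * (p : ℝ) ^ 6) -
        16 * T3 - 80 * Tmax))) +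
      4 * ((d : ℝ) - 1) * (((d : ℝ) - 2) * ((p : ℝ) ^ 6 * (16 - 8 * (p : ℝ) - 40 * (p : ℝ) ^ 2 -
        56 * (p : ℝ) ^ 3 - 104 * (p : ℝ) ^ 4 - 32 * (p : ℝ) ^ 5 - 16 * (p : ℝ) ^ 6 -
        (((d : ℝ) - 2) - 1) * (16 * (p : ℝ) ^ 3 + 144 * (p : ℝ) ^ 4 + 64 * (p : ℝ) ^ 5 + 32 * (p : ℝ) ^ 6) -
        16 * T3 - 80 * Tmax)))) := by ring
  have hfourth : (3 / 2) * ((2 * d - 2 : ℝ) * (2 * d - 3) * (2 * d - 4)) *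
        ((p : ℝ) ^ 6 * (1 - 8 * (p : ℝ) ^ 2 - 5 * Tmax - T3)) =
      (1 / 6) * (9 * ((2 * d - 2 : ℝ) * (2 * d - 3) * (2 * d - 4)) *
        ((p : ℝ) ^ 6 * (1 - 8 * (p : ℝ) ^ 2 - 5 * Tmax - T3))) := by ring
  have hsplit : ∑ q ∈ twoPairs κ, (((p : ℝ) ^ 4 - (p : ℝ) ^ 4 * psiTwoSub d p κ q) +
      ∑ f ∈ hexTwoFam κ q, (hexTwoPoly p (thirdAxes κ q).card f.2 - (p : ℝ) ^ 6 * psiHexTwoSub d p κ q f.1 f.2)) =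
      ∑ q ∈ twoPairs κ, ((p : ℝ) ^ 4 - (p : ℝ) ^ 4 * psiTwoSub d p κ q) +
        ∑ q ∈ twoPairs κ, ∑ f ∈ hexTwoFam κ q,
          (hexTwoPoly p (thirdAxes κ q).card f.2 - (p : ℝ) ^ 6 * psiHexTwoSub d p κ q f.1 f.2) :=
    Finset.sum_add_distrib
  rw [hsplit, hsecond, hthird, hfourth]
  linarith

/-- **The field `NobleAssumption43At.psiZeroLower` from the kernel of lines 1–5 with all three position classes**:
any `L` below the closed form of `FvdH17ext_L53_psiZero_lines12345_lower_of_tau_le` is a valid uniform-in-`ι` lower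
bound `L ≤ Ψ̂^{(0),ι}_p(0)`, with the summability.  This is the form a certificate revision consumes; it licenses the
three hexagon addends TOGETHER on top of the lines-1–3 kernel.
[cite: FitznerVanDerHofstad2017, Lemma 5.3 (5.25) (extended version arXiv:1506.07977v1 p. 48); Section 4.2 (4.35)] -/
theorem FvdH17ext_L53_psiZeroLower_field_lines12345 (hd : 3 ≤ d) (p : unitInterval) (hp : p < criticalProbI d)
    {a b c : Fin d} (hab : a ≠ b) (hac : a ≠ c) (hbc : b ≠ c) {T2 T11 T21 T111 T3 Tmax : ℝ}
    (h2 : tau d p 0 (Pi.single a 2) ≤ T2) (h11 : tau d p 0 (Pi.single a 1 + Pi.single b 1) ≤ T11)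
    (h21 : tau d p 0 (Pi.single a 2 + Pi.single b 1) ≤ T21)
    (h111 : tau d p 0 (Pi.single a 1 + Pi.single b 1 + Pi.single c 1) ≤ T111) (h3 : tauGe d p 3 (unitSite1 d) ≤ T3)
    (hT2 : T2 ≤ T11) (hT21 : T21 ≤ T111)
    (hmax : ∀ z : Site d, z ≠ 0 → (∀ ν : Fin d × Bool, z ≠ 𝐞 ν) → tau d p 0 z ≤ Tmax) {L : ℝ}
    (hL : L ≤ (p : ℝ) * ((2 * d - 2 : ℝ) ^ 2 * (p : ℝ) ^ 3 -
        ((p : ℝ) ^ 3 * ((2 * d - 2 : ℝ) * (2 * T2 + 2 * (2 * d - 3 : ℝ) * T11 + 2 * T21 + (2 * d - 4 : ℝ) * T111)) +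
          (2 * d - 2 : ℝ) ^ 2 * (p : ℝ) ^ 3 * T3 + (2 * d - 2 : ℝ) * (2 * d - 3) ^ 2 * (p : ℝ) ^ 6)) +
      2 * ((d : ℝ) - 1) ^ 2 * (p : ℝ) ^ 4 * (1 - T111 - 2 * T11 - T3) +
      16 * ((d : ℝ) - 1) * ((d : ℝ) - 2) * (2 * (d : ℝ) - 5) * ((p : ℝ) ^ 6 * hexOneBracket d p Tmax T3) +
      2 * ((d : ℝ) - 1) * ((d : ℝ) - 2) * (p : ℝ) ^ 6 *
        (((d : ℝ) - 2) * (16 - 8 * (p : ℝ) - 40 * (p : ℝ) ^ 2 - 56 * (p : ℝ) ^ 3 - 104 * (p : ℝ) ^ 4 -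
            32 * (p : ℝ) ^ 5 - 16 * (p : ℝ) ^ 6 - 16 * T3 - 80 * Tmax) -
          ((d : ℝ) - 3) ^ 2 * (16 * (p : ℝ) ^ 3 + 144 * (p : ℝ) ^ 4 + 64 * (p : ℝ) ^ 5 + 32 * (p : ℝ) ^ 6)) +
      (3 / 2) * ((2 * d - 2 : ℝ) * (2 * d - 3) * (2 * d - 4)) * ((p : ℝ) ^ 6 * (1 - 8 * (p : ℝ) ^ 2 - 5 * Tmax - T3))) :
    ∀ ι : Fin d × Bool, Summable (fun x => noblePsiN d p (𝐞 ι) 0 x) ∧ L ≤ ∑' x, noblePsiN d p (𝐞 ι) 0 x :=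
  fun ι => ⟨summable_noblePsiN (by omega) hp (𝐞 ι) 0,
    hL.trans (FvdH17ext_L53_psiZero_lines12345_lower_of_tau_le hd p hp hab hac hbc h2 h11 h21 h111 h3 hT2 hT21 hmax ι)⟩

end Literature.Probability.FitznerVanDerHofstad2017

end
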